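import Summits.QuantumFields.YangMills.Theorems.BalabanUVNodesN16Thm4TorusOfHP2PerPrint

/-!
# Route «BalabanUVNodes», crux K3⁸ `SpineGivenEndpointR13SepCoPHV` (stmt-QuantumFields-27366), node N16 = NE3 — THE PRINT-LIST EDITION READ AT NODE N05's WITNESS
# SLOT OF RECORD: the κ-periodic δ₂-slot `Node00.B8LeafOfRecordSubBP₂DPerκ θ P M₁ R lam` (its `t4` ∧ `p3` conjuncts) at the truncated all-torus member of its cut ⟹
# node N16's entry `Thm4TorusAt θ.L k P L⁻ᵏ c₁′ (unitaryUnits θ.𝔸) Reg (Restr129 θ.L k (torusLam k)) Concl_print` for every `c₁′` in the window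

Cell `pub-ymgap`, seat `pub-ymgap-dag-n16-e` (R134 (a), strategy s2; HUMAN RULING D-0062; chair R424 venue), generation 23; companion (§3, split for the 400-line rule) of
`…N16Thm4TorusOfHP2PerPrint`.  `--kind proof --supports stmt-QuantumFields-27366 --as helper` (count-neutral; proves NO registered stub).  `bears_on: R4∕N16 · edge N05 → N16`.

WHAT THIS FILE PROVES (kernel; one theorem, 0 `def`, 0 `sorry`): ★★★ `exists_thm4TorusAt_print_of_b8LeafOfRecordSubBP₂DPerκ` — for Stage-3 parameters `θ` (`θ.D ≥ 2`), any period
`P`, pins `(M₁, R)`, residual layer `lam` with the displayed letters `0 ≤ β`, `len ≥ 1` on its support, `0 < B₁′`, `5dL·inp.B₀ ≤ B₁′` (all fields of `lam.base`): the slot gives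
thresholds `c₁, cP > 0` (Theorem 4's and Proposition 3's, EXISTENTIAL in the slot's `Thm4Printed` ∕ `Prop3Printed`) such that for every `c₁′` in n16-c's eleven-line window and
every depth `k ≥ 1` with `Lᵏ ∣ P`: `Thm4TorusAt θ.L k P L⁻ᵏ c₁′ … Concl_print(5dL·inp.B₀, 5dL·B₀β; β)` — `…HP2PerPrint.thm4TorusAt_print_of_hp2per_member` at the `univFam k`
member (`B8IdxB8SubDPerUnivFam.exists_idxB8SubDPerκ_univFam`, towers by rigidity) on the slot's `t4` ∕ `p3` fields (`famB8OfRecordSubBP₂DPer_kappa_eq`, `rfl`).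

HONEST FRAMING.  Bookkeeping BY NAME; no estimate; the slot is a HYPOTHESIS (node N05's theorem inhabits it); the thresholds stay existential PER SLOT INSTANCE — the
uniformity in `P` that `…N16HolderOfThm4Output.n16_holder_of_thm4TorusAt_print` needs ((g6) of the LOCATED note) is NOT supplied here; nothing of Bałaban asserted; no stub of
K3⁸ closed or claimed; N16 ∕ N05 NOT discharged; counts UNMOVED (typed 28∕28 · discharged 5∕27 · A 5∕28).  One finite four-torus at fixed `ε` — NOT ℝ⁴, NOT infinite volume,
NOT OS, NOT a mass gap; the YM mass gap (Clay) is NOT proved by any of this.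
References: [Balaban1985RegularSpaces] T. Bałaban, CMP **99** (1985) 75–102, Thm 4 p. 88, Prop. 3 p. 87, (1.3)–(1.5) p. 77, (1.36)–(1.39) pp. 82–83.
-/

set_option autoImplicit false

open scoped BigOperators
open NormedSpace

namespace Summit.QuantumFields.YangMills.BalabanUVNodes.N16.Thm4TorusOfHP2PerPrintSlot

open Literature.MathematicalPhysics.QuantumFieldTheory.Balaban1983to89
open B7Prop1Explicit B7Prop2Explicit
open B7Prop3Flat (c3)
open B7Eq78Linearization (conjR)
open B7Eq92Concrete (mgauge)
open B8Ineq132 (covDerivFwd)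
open B8Eq184Proof (cfgExp)
open B8Eq119TwistedAxial (Restr129)
open B8Eq138LandauZd (IsLandau138 covLap)
open B9Eq340HolderZd (AdmPair)
open B8Thm4TorusAt (torusLam Thm4TorusAt)
open B8LeafModelZdHP2Per (zdGF3HP₂Per)
open T4TermwiseTorus (IsPeriodic)
open Node00 (Stage3Params IdxB8SubDPerκ ResidB8Per B8LeafOfRecordSubBP₂DPerκ)
open B8Eq134Admissible (univFam)
open B8IdxB8SubDPerUnivFam (exists_idxB8SubDPerκ_univFam univFam_of_le)
open Thm4TorusOfHP2PerPrint (thm4TorusAt_print_of_hp2per_member)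

noncomputable section

/-- **★★★ NODE N16's PRINT-LIST TORUS READING OF [B8] THEOREM 4 ∧ PROPOSITION 3 FROM NODE N05's WITNESS SLOT OF RECORD.**  For `θ` with `θ.D ≥ 2`, period `P`, pins
`(M₁, R)`, residual layer `lam : ResidB8Per θ P` with `0 ≤ lam.base.β`, `lam.base.len ≥ 1` on its support, `0 < lam.base.B₁′`, `5·D·L·lam.base.inp.B₀ ≤ lam.base.B₁′`: the
κ-periodic δ₂-slot `Node00.B8LeafOfRecordSubBP₂DPerκ θ P M₁ R lam` yields `c₁, cP > 0` (its `t4` ∕ `p3` thresholds) such that, for every `c₁′` placing `(α₀, α₁, B₁′(α₀+α₁))` in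
Theorem 4's ∕ Proposition 3's ∕ Proposition 2's ∕ the (1.42)-lemma's windows (n16-c's `hwin`, eleven lines) and EVERY depth `k ≥ 1` with `Lᵏ ∣ P` (`0 < P`), for every `Reg`:
`Thm4TorusAt θ.L k P L⁻ᵏ c₁′ (unitaryUnits θ.𝔸) Reg (Restr129 θ.L k (torusLam k)) Concl_print` with print's list (‖A‖ ≤ B s, ‖D A‖ ≤ B s (Lᵏ·L⁻ᵏ)⁻², (1.38), the (1.36)₃ Hölder line
`B_h s (Lᵏ·L⁻ᵏ)^{−(2+β)} (L⁻ᵏ·len e_μ)^β` on `AdmPair`, ‖Δ A‖ ≤ B s (Lᵏ·L⁻ᵏ)⁻³; `B = 5DL·inp.B₀`, `B_h = 5DL·B₀β`, `s = α₀ + α₁`) and `IsPeriodic P A` — §2 of the companion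
file at the `univFam k` member.  The letters `(Lᵏ·L⁻ᵏ)` are the companion's `(Lᵏη)` at `η = L⁻ᵏ`, verbatim (`= 1`).
[cite: Balaban1985RegularSpaces, Thm 4 p.88, Prop. 3 p.87, (1.36)–(1.39) pp.82–83, (1.3)–(1.5) p.77 («we admit the case where some domains Ω_j are equal to T_η»); Balaban1987RG1, (0.1) p.251] -/
theorem exists_thm4TorusAt_print_of_b8LeafOfRecordSubBP₂DPerκ {θ : Stage3Params} (hD : 2 ≤ θ.D) {P M₁ R : ℕ} (lam : ResidB8Per θ P)
    (h : B8LeafOfRecordSubBP₂DPerκ θ P M₁ R lam) (hβ : 0 ≤ lam.base.β) (hlen : ∀ v : Site θ.D, 0 < lam.base.len v → 1 ≤ lam.base.len v)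
    (hB₁' : 0 < lam.base.B₁') (hBB : 5 * (θ.D : ℝ) * θ.L * lam.base.inp.B₀ ≤ lam.base.B₁')
    {k : ℕ} (hk : 1 ≤ k) (hP : 0 < P) (hdvd : θ.L ^ k ∣ P) (Reg : (Site θ.D → Fin θ.D → θ.𝔸ˣ) → Prop) :
    ∃ c₁ cP : ℝ, 0 < c₁ ∧ 0 < cP ∧ ∀ c₁' : ℝ,
      (∀ α₀ α₁ : ℝ, 0 < α₀ → 0 < α₁ → α₀ + α₁ ≤ c₁' →
        α₀ + α₁ ≤ c₁ ∧ C0 θ.D * (2 * α₀) ≤ 1 / 3 ∧ 4 * α₀ ≤ c2' θ.D θ.L ∧ 16 * (lam.base.B₁' * (α₀ + α₁)) ≤ 1 ∧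
        Real.exp (4 * (800 * ((θ.D : ℝ) + 1) ^ 2 * ((θ.D : ℝ) + 4)) * α₀) * (1 + 8 * (131072 * ((θ.D : ℝ) + 1) ^ 2) * (lam.base.B₁' * (α₀ + α₁))) ≤ 2 ∧
        2 * (lam.base.B₁' * (α₀ + α₁)) ≤ c3 θ.D θ.L ∧ (θ.D : ℝ) * θ.L * α₁ ≤ 1 / 8 ∧ α₀ ≤ cP ∧ α₁ ≤ cP ∧ lam.base.B₁' * (α₀ + α₁) ≤ cP ∧
        2 * (lam.base.B₁' * (α₀ + α₁)) ^ 2 + 20 * θ.D * α₀ * (lam.base.B₁' * (α₀ + α₁)) + 2 * lam.base.C₂ * (lam.base.B₁' * (α₀ + α₁)) ^ 2 ≤ α₀ + α₁) →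
      Thm4TorusAt θ.L k (P : ℤ) (((θ.L : ℝ) ^ k)⁻¹) c₁' (unitaryUnits θ.𝔸) Reg (Restr129 θ.L k (torusLam k))
        (fun (α₀ α₁ : ℝ) (U₀ U' : Site θ.D → Fin θ.D → θ.𝔸ˣ) (u : Site θ.D → θ.𝔸ˣ) =>
          ∃ A : Site θ.D → Fin θ.D → θ.𝔸,
            (∀ x μ, IsSelfAdjoint (A x μ)) ∧ IsPeriodic P A ∧ mgauge U₀ u (cfgExp (((θ.L : ℝ) ^ k)⁻¹) A) = U' ∧
            (∀ x μ, ‖A x μ‖ ≤ 5 * (θ.D : ℝ) * θ.L * lam.base.inp.B₀ * (α₀ + α₁) * ((θ.L : ℝ) ^ k * ((θ.L : ℝ) ^ k)⁻¹)⁻¹) ∧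
            (∀ (μ : Fin θ.D) (x : Site θ.D) (κ : Fin θ.D),
              ‖covDerivFwd (((θ.L : ℝ) ^ k)⁻¹) U₀ μ (fun z => A z κ) x‖
                ≤ 5 * (θ.D : ℝ) * θ.L * lam.base.inp.B₀ * (α₀ + α₁) * ((θ.L : ℝ) ^ k * ((θ.L : ℝ) ^ k)⁻¹) ^ (-(2 : ℝ))) ∧
            IsLandau138 θ.L k (((θ.L : ℝ) ^ k)⁻¹) Set.univ (torusLam k) U₀ A ∧
            (∀ (μ : Fin θ.D) (y : Site θ.D) (κ : Fin θ.D), (y, y + e μ) ∈ AdmPair (((θ.L : ℝ) ^ k)⁻¹) lam.base.len →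
              ‖conjR (U₀ y μ) (covDerivFwd (((θ.L : ℝ) ^ k)⁻¹) U₀ μ (fun z => A z κ) (y + e μ)) - covDerivFwd (((θ.L : ℝ) ^ k)⁻¹) U₀ μ (fun z => A z κ) y‖
                ≤ 5 * (θ.D : ℝ) * θ.L * lam.base.B₀β * (α₀ + α₁) * ((θ.L : ℝ) ^ k * ((θ.L : ℝ) ^ k)⁻¹) ^ (-(2 + lam.base.β)) *
                  ((((θ.L : ℝ) ^ k)⁻¹) * lam.base.len (e μ)) ^ lam.base.β) ∧
            (∀ (x : Site θ.D) (κ : Fin θ.D),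
              ‖covLap (((θ.L : ℝ) ^ k)⁻¹) U₀ (fun z => A z κ) x‖
                ≤ 5 * (θ.D : ℝ) * θ.L * lam.base.inp.B₀ * (α₀ + α₁) * ((θ.L : ℝ) ^ k * ((θ.L : ℝ) ^ k)⁻¹) ^ (-(3 : ℝ)))) := by
  obtain ⟨j, hη, hjk, hΩ⟩ := exists_idxB8SubDPerκ_univFam θ M₁ R hk hP hdvd
  -- the slot's `t4` ∕ `p3` conjuncts, on the periodic δ₂-model at the cut members (`famB8OfRecordSubBP₂DPer_kappa_eq`, `rfl`)
  have h4 : B8.Thm4Printed lam.base.B₁'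
      (fun a : IdxB8SubDPerκ θ P M₁ R => (zdGF3HP₂Per θ.𝔸 θ.L lam.base.β lam.base.len a.toZdIdx P).toGFData) := h.t4
  have h3 : B8.Prop3Printed θ.D (θ.L : ℝ) lam.base.C₂ lam.base.inp lam.base.B₀β
      (fun a : IdxB8SubDPerκ θ P M₁ R => (zdGF3HP₂Per θ.𝔸 θ.L lam.base.β lam.base.len a.toZdIdx P).toGFData2) := h.p3
  obtain ⟨c₁, hc₁, H4⟩ := h4
  obtain ⟨cP, hcP, H3⟩ := h3
  -- the member's sets on the levels read
  have hΩ' : ∀ l, l ≤ j.toZdIdx.k → j.toZdIdx.Ω l = Set.univ := fun l hl => by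
    rw [hΩ]; exact univFam_of_le (by rw [hjk] at hl; exact hl)
  have hΛs' : ∀ m, m ≤ j.toZdIdx.k → ∀ l, l ≤ m → j.toZdIdx.Λs m l = torusLam m l := fun m hm l hl => by
    rw [B8IdxB8SubDPerUnivFam.IdxB8SubDPerκ.Λs_univFam j hΩ hjk (by rw [hjk] at hm; exact hm) hl]
    rfl
  refine ⟨c₁, cP, hc₁, hcP, fun c₁' hwin => ?_⟩
  have hT := thm4TorusAt_print_of_hp2per_member (𝔸 := θ.𝔸) hD θ.two_le_L hβ hlen j.toZdIdx P hΩ' hΛs' hB₁' hBB hwin Reg (H4 j) (H3 j)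
  rw [← hη, ← hjk]
  exact hT

end

end Summit.QuantumFields.YangMills.BalabanUVNodes.N16.Thm4TorusOfHP2PerPrintSlot
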